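import Literature.InformationTheory.Entanglement.EntanglementBreakingChannels
import Literature.InformationTheory.Entanglement.HorodeckiCriterion
import Literature.LinearAlgebra.Matrix.PositiveMapInducedTraceNorm
import Literature.LinearAlgebra.Matrix.KrausChannelCharacterizations
import Literature.LinearAlgebra.Matrix.ChoiRankKrausRepresentations
import HarnessLib

/-!
# Entanglement-breaking maps: rank-one Kraus operators and composition with positive maps
# (Horodecki–Shor–Ruskai 2003, Theorem 4, conditions (D), (E), (F))

Hodge foundations lane (`lit-hodgefound`, prover p24 gen 70 #7; quantum-information series, sequel of
`EntanglementBreakingChannels.lean` (gen 69 #14: Theorem 4 (A) ⟺ (B) ⟺ (C), (D) ⇒ (A)) and of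
`HorodeckiCriterion.lean` (gen 68: Watrous' Theorem 6.9 = [H3] of the source)).  THEOREMS ONLY: no definition, no
named fact, net debt 0.  Conventions of the tree (as in the prequel): a linear `Φ : M_n(ℂ) → M_m(ℂ)`; its ampliation
`(1_p ⊗ Φ)(X) = comp p p m m ℂ (((comp p p n n ℂ).symm X).map Φ)` (`ChoiTheoremCompletelyPositiveMaps.lean`);
«completely positive» = `(1_{ℂ^k} ⊗ Φ)(X) ⪰ 0` for all `k : ℕ` and all `X ⪰ 0` (`choi_theorem_1`); «positivity
preserving» `Υ` = `∀ Y ⪰ 0, Υ(Y) ⪰ 0`; the Choi matrix `J(Φ) = comp n n m m ℂ (of fun j k => Φ (E_jk))`; the Holevo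
form (A) `Φ(X) = Σ_a Tr(F_a X) R_a` with `F_a, R_a ⪰ 0`; a rank-one Kraus operator `|w⟩⟨u| = vecMulVec w (star u)`;
the adjoint `Φ^*` of `PositiveMapInducedTraceNorm.lean` is carried as a HYPOTHESIS
`∀ X Y, Tr((Ψ Y)^* X) = Tr(Y^* Φ(X))` (`exists_adjoint`, `adjoint_positive`); separability of a state is
`PPT.IsSeparable`, of an operator the cone form `R = Σ_a P_a ⊗ Q_a`, `P_a, Q_a ⪰ 0` of `HorodeckiCriterion.lean`.

## Source, VERBATIM — M. Horodecki, P. W. Shor, M. B. Ruskai, *Entanglement breaking channels*, Rev. Math. Phys.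
**15** (2003) 629–641 [HorodeckiShorRuskai2003] (held `paper:arxiv-quant-ph_0302031`, chunk p0005, § 2)

«**Theorem 4.** The following are equivalent: A) `Φ` has the Holevo form (1) with `F_k` positive semi-definite.
B) `Φ` is entanglement breaking. C) `(I ⊗ Φ)(|β⟩⟨β|)` is separable for `|β⟩ = d^{-1/2} Σ_j |j⟩ ⊗ |j⟩` a maximally
entangled state. D) `Φ` can be written in operator sum form using only Kraus operators of rank one.
E) `Υ ∘ Φ` is completely positive for all positivity preserving maps `Υ`. F) `Φ ∘ Υ` is completely positive for
all positivity preserving maps `Υ`.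
A corresponding equivalence holds for CPT and EBT maps with the additional conditions that `{F_k}` is a POVM, the
Kraus operators `A_k` satisfy `Σ_k A_k^† A_k = I`, and `Υ` is trace-preserving. …
[after the proof of (C) ⇒ (A) through normalized vectors `|v_n⟩`, `|w_n⟩`:] Moreover, we have also shown that
(C) ⇒ (D).
To show that (D) ⇒ (A), suppose that `Φ(ρ) = Σ_k A_k ρ A_k^†` with `A_k = |w_k⟩⟨u_k|`. Then the map `Φ` can be
written in the form (1) with `R_k = |u_k⟩⟨u_k|`. Moreover, when `Σ_k A_k^† A_k = I`, then `Σ_k |u_k⟩⟨u_k| = I` so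
that `F_k = |u_k⟩⟨u_k|` defines a POVM.
The equivalence of (E) and (B) follows easily from the fact that a density matrix `Γ` is separable if and only if
`(I ⊗ Ω)(Γ) > 0` for all positivity preserving maps `Ω` [H3]. To see that this is equivalent to (F), it suffices to
observe that `Ω` is positivity preserving if and only if its adjoint `Ω̂` is and that `(Φ ∘ Υ)^ = Υ̂ ∘ Φ̂`, where
the adjoint is taken with respect to the Hilbert Schmidt inner product so that `Tr [Ω̂(A)]^† B = Tr A^† Ω(B)`.
It may be interesting to recall that `Υ` is trace-preserving if and only if `Υ̂` is unital so that the adjoint of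
a positivity and trace preserving map preserves POVM's. Thus, when `Φ` has the form (1), the map `Φ ∘ Υ` is
achieved by replacing `E_k` by `Υ̂(E_k)`.»

## Dictionary and deviations (recorded)

* (A) ⇒ (D): the source reaches (D) from the pure-state decomposition in its proof of (C) ⇒ (A); the tree's
  `IsSeparable` has mixed factors, so we refine a Holevo form `(F_a, R_a)` by the spectral decompositions
  `F_a = Σ_i u_{a,i}u_{a,i}^*`, `R_a = Σ_j w_{a,j}w_{a,j}^*` (`ChoiRankKrausRepresentations`) and read
  `Tr(F_a X) R_a = Σ_{i,j} |w_{a,j}⟩⟨u_{a,i}| X |u_{a,i}⟩⟨w_{a,j}|` off the prequel's `rankOne_conj_eq`; the Kraus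
  family is indexed by `ι × n × m` and satisfies `Σ_t A_t^† A_t = Σ_a Tr(R_a) F_a` (the POVM clause).
* (E), (F) quantify over positivity preserving maps into / out of `M_k(ℂ)`, all `k : ℕ` (every `M_q` is of this
  form up to re-indexing, cf. `horodecki_criterion`).  (A) ⇒ (E)/(F): `Υ ∘ Φ` has the Holevo form
  `(F_a, Υ(R_a))`, `Φ ∘ Υ` the Holevo form `(Υ^*(F_a), R_a)`, and a Holevo-form map is completely positive
  (`(1 ⊗ Φ)(X) = Σ_a G_a ⊗ R_a`, prequel).  (E) ⇒ (A): `Φ` is completely positive (`Υ = ` a re-indexing), so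
  `J(Φ) ⪰ 0`, and `(1 ⊗ Υ)(J(Φ)) = (1 ⊗ Υ∘Φ)(J(id)) ⪰ 0` for every positive `Υ`; by [H3] = Watrous' Theorem 6.9
  (`horodecki_criterion`) `J(Φ) = Σ_a P_a ⊗ Q_a`, whence `Φ(X) = Σ_a Tr(P_aᵀ X) Q_a`.  (E) ⇒ (B) for channels:
  the same criterion applied to `(1 ⊗ Φ)(Γ)` directly.  (F) ⇒ (A): exactly as printed — `Φ̂` satisfies (E)
  (`Υ ∘ Φ̂` is the adjoint of the Kraus map `Φ ∘ Υ̂`, hence Kraus), so `Φ̂` has a Holevo form `(F_a, R_a)` and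
  `Φ = Φ̂^` the Holevo form `(R_a, F_a)`.
* (B) ⇒ (E) is routed through the prequel's (B) ⇒ (C) ⇒ (A) (its (B) quantifies over inputs on `ℂⁿ ⊗ ℂⁿ`).

## What is formalized (all PROVED)

* § 1 (A) ⇒ (D): `exists_eq_sum_vecMulVec`, `trace_mul_smul_eq_sum_rankOne_conj`, `conjTranspose_rankOne_mul_self`,
  **`exists_rankOne_kraus_of_holevoForm`** (with `Σ_t A_t^†A_t = Σ_a Tr(R_a) F_a`),
  `exists_rankOne_kraus_of_holevoForm_povm` (channels: `Σ_t A_t^†A_t = 1`), **`holevoForm_iff_rankOne_kraus`**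
  ((A) ⟺ (D)), `exists_rankOne_kraus_of_isSeparable_choi` ((C) ⇒ (D)), `amp_posSemidef_of_rankOne_kraus`.
* § 2 (A) ⇒ (E), (F): `amp_posSemidef_of_holevoForm`, **`amp_comp_posSemidef_of_holevoForm`** ((A) ⇒ (E)),
  `holevoForm_comp_of_adjoint` («replacing `E_k` by `Υ̂(E_k)`»), `sum_adjoint_eq_one` (POVMs are preserved),
  **`comp_amp_posSemidef_of_holevoForm`** ((A) ⇒ (F)), `trace_comp_of_tracePreserving`.
* § 3 (E) ⇒ (A), (B): `amp_posSemidef_of_cp_comp_positive`, `choi_eq_sum_kronecker_of_cp_comp_positive`,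
  `holevoForm_of_choi_eq_sum_kronecker`, **`holevoForm_of_cp_comp_positive`** ((E) ⇒ (A)),
  `trace_amp_of_tracePreserving`, **`isSeparable_amp_of_cp_comp_positive`** ((E) ⇒ (B)),
  `amp_comp_posSemidef_of_entanglementBreaking` ((B) ⇒ (E)), **`holevoForm_iff_cp_comp_positive`**,
  **`entanglementBreaking_iff_cp_comp_positive`**.
* § 4 (F) ⇒ (A): `holevoForm_of_adjoint_holevoForm` (`Φ̂` of a Holevo form), `kraus_comp_adjoint`
  (`Υ ∘ Φ̂ = (Φ ∘ Υ̂)^` is Kraus), **`holevoForm_of_comp_cp_positive`** ((F) ⇒ (A)),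
  **`holevoForm_iff_comp_cp_positive`** ((A) ⟺ (F)).
-/

noncomputable section

open Matrix Finset
open scoped ComplexOrder MatrixOrder Kronecker

namespace Literature.InformationTheory.Entanglement.EntanglementBreakingConditions

open Literature.InformationTheory.Entanglement.PPT (IsSeparable)
open Literature.InformationTheory.Entanglement.SepDecomp (isSeparable_iff_sepD)
open Literature.InformationTheory.Entanglement.Horodecki (horodecki_criterion)
open Literature.InformationTheory.Entanglement.EntanglementBreakingChannels (amp_holevoForm posSemidef_blockTrace
  rankOne_conj_eq holevoForm_of_rankOne_kraus isSeparable_choi_of_entanglementBreaking holevoForm_of_isSeparable_choi)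
open Literature.LinearAlgebra.Matrix.ChoiTheoremCompletelyPositiveMaps (amp_apply amp_comp amp_posSemidef_of_forall_fin
  amp_posSemidef_of_kraus choi_eq_amp posSemidef_comp_single choi_theorem_1 choi_theorem_2 eq_of_apply_single_eq)
open Literature.LinearAlgebra.Matrix.PositiveMapInducedTraceNorm (exists_adjoint adjoint_symm adjoint_positive
  eq_of_forall_trace_conjTranspose_mul_eq tracePreserving_iff_adjoint_map_one)
open Literature.LinearAlgebra.Matrix.KrausChannelCharacterizations (trace_conjTranspose_kraus_mul)
open Literature.LinearAlgebra.Matrix.ChoiRankKrausRepresentations (posSemidef_eq_sum_vecMulVec_eigenvector)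

variable {n m p q : Type*} [Fintype n] [DecidableEq n] [Fintype m] [DecidableEq m] [Fintype p] [DecidableEq p]
  [Fintype q] [DecidableEq q]
variable {ι : Type} [Fintype ι]

/-! ## § 1 (A) ⇒ (D): a Holevo form yields rank-one Kraus operators -/

section AtoD

/-- A positive semidefinite matrix is a sum of rank-one positive operators `C = Σ_i u_iu_i^*`
(`u_i = √λ_i x_i` for an orthonormal eigenbasis `x_i`). [cite: HorodeckiShorRuskai2003, Theorem 4 ((C) ⇒ (D):
«one can find normalized vectors `|v_n⟩` and `|w_n⟩` …»)] -/
theorem exists_eq_sum_vecMulVec {N : Type*} [Fintype N] [DecidableEq N] {C : Matrix N N ℂ} (hC : C.PosSemidef) :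
    ∃ u : N → N → ℂ, C = ∑ i, vecMulVec (u i) (star (u i)) := by
  refine ⟨fun i => star fun x => ((Real.sqrt (hC.1.eigenvalues i) : ℝ) : ℂ) *
    star ((hC.1.eigenvectorUnitary : Matrix N N ℂ) x i), ?_⟩
  simp_rw [star_star]
  exact posSemidef_eq_sum_vecMulVec_eigenvector hC

omit [DecidableEq n] [Fintype m] [DecidableEq m] in
/-- `Tr(F X) R = Σ_{i,j} |w_j⟩⟨u_i| X |u_i⟩⟨w_j|` for `F = Σ_i u_iu_i^*` and `R = Σ_j w_jw_j^*`.
[cite: HorodeckiShorRuskai2003, Theorem 4 ((D) ⇒ (A), read backwards)] -/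
theorem trace_mul_smul_eq_sum_rankOne_conj {κ₁ κ₂ : Type*} [Fintype κ₁] [Fintype κ₂] (u : κ₁ → n → ℂ)
    (w : κ₂ → m → ℂ) (X : Matrix n n ℂ) :
    ((∑ i, vecMulVec (u i) (star (u i))) * X).trace • ∑ j, vecMulVec (w j) (star (w j)) =
      ∑ i, ∑ j, vecMulVec (w j) (star (u i)) * X * (vecMulVec (w j) (star (u i)))ᴴ := by
  rw [Finset.sum_mul, trace_sum, Finset.sum_smul]
  refine Finset.sum_congr rfl fun i _ => ?_
  rw [Finset.smul_sum]
  refine Finset.sum_congr rfl fun j _ => ?_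
  rw [rankOne_conj_eq]

omit [Fintype n] [DecidableEq n] [DecidableEq m] in
/-- `(|w⟩⟨u|)^† |w⟩⟨u| = ⟨w|w⟩ |u⟩⟨u|`. [cite: HorodeckiShorRuskai2003, Theorem 4 ((D) ⇒ (A): «when
`Σ_k A_k^† A_k = I`, then `Σ_k |u_k⟩⟨u_k| = I`»)] -/
theorem conjTranspose_rankOne_mul_self (w : m → ℂ) (u : n → ℂ) :
    (vecMulVec w (star u))ᴴ * vecMulVec w (star u) = (star w ⬝ᵥ w) • vecMulVec u (star u) := by
  rw [conjTranspose_vecMulVec, star_star, vecMulVec_mul_vecMulVec, vecMulVec_smul]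

/-- **Theorem 4, (A) ⇒ (D)**: a map of Holevo form `Φ(X) = Σ_a Tr(F_a X) R_a` with `F_a, R_a ⪰ 0` has an
operator-sum representation with rank-one Kraus operators `A_t = |w_t⟩⟨u_t|`, `t ∈ ι × n × m`; moreover
`Σ_t A_t^† A_t = Σ_a Tr(R_a) F_a`. [cite: HorodeckiShorRuskai2003, Theorem 4 ((A) ⟺ (D), «Moreover, we have also
shown that (C) ⇒ (D)»)] -/
theorem exists_rankOne_kraus_of_holevoForm (Φ : Matrix n n ℂ →ₗ[ℂ] Matrix m m ℂ) (F : ι → Matrix n n ℂ)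
    (R : ι → Matrix m m ℂ) (hF : ∀ a, (F a).PosSemidef) (hR : ∀ a, (R a).PosSemidef)
    (hΦ : ∀ X, Φ X = ∑ a, (F a * X).trace • R a) :
    ∃ (w : ι × n × m → m → ℂ) (u : ι × n × m → n → ℂ),
      (∀ X, Φ X = ∑ t, vecMulVec (w t) (star (u t)) * X * (vecMulVec (w t) (star (u t)))ᴴ) ∧
      ∑ t, (vecMulVec (w t) (star (u t)))ᴴ * vecMulVec (w t) (star (u t)) = ∑ a, (R a).trace • F a := by
  choose u hu using fun a => exists_eq_sum_vecMulVec (hF a)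
  choose w hw using fun a => exists_eq_sum_vecMulVec (hR a)
  refine ⟨fun t => w t.1 t.2.2, fun t => u t.1 t.2.1, fun X => ?_, ?_⟩
  · rw [hΦ X]
    simp only [Fintype.sum_prod_type]
    refine Finset.sum_congr rfl fun a _ => ?_
    rw [hu a, hw a, trace_mul_smul_eq_sum_rankOne_conj]
  · simp only [Fintype.sum_prod_type, conjTranspose_rankOne_mul_self]
    refine Finset.sum_congr rfl fun a _ => ?_
    rw [hu a, Finset.smul_sum]
    refine Finset.sum_congr rfl fun i _ => ?_
    rw [← Finset.sum_smul]
    congr 1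
    rw [hw a, trace_sum]
    exact Finset.sum_congr rfl fun j _ => by rw [trace_vecMulVec, dotProduct_comm]

/-- **Theorem 4, (A) ⇒ (D) for channels**: if moreover the `R_a` are density operators and `{F_a}` is a POVM, the
rank-one Kraus operators satisfy `Σ_t A_t^† A_t = I`. [cite: HorodeckiShorRuskai2003, Theorem 4 («A corresponding
equivalence holds for CPT and EBT maps … the Kraus operators `A_k` satisfy `Σ_k A_k^† A_k = I`»)] -/
theorem exists_rankOne_kraus_of_holevoForm_povm (Φ : Matrix n n ℂ →ₗ[ℂ] Matrix m m ℂ) (F : ι → Matrix n n ℂ)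
    (R : ι → Matrix m m ℂ) (hF : ∀ a, (F a).PosSemidef) (hFsum : ∑ a, F a = 1)
    (hR : ∀ a, (R a).PosSemidef ∧ (R a).trace = 1) (hΦ : ∀ X, Φ X = ∑ a, (F a * X).trace • R a) :
    ∃ (w : ι × n × m → m → ℂ) (u : ι × n × m → n → ℂ),
      (∀ X, Φ X = ∑ t, vecMulVec (w t) (star (u t)) * X * (vecMulVec (w t) (star (u t)))ᴴ) ∧
      ∑ t, (vecMulVec (w t) (star (u t)))ᴴ * vecMulVec (w t) (star (u t)) = 1 := by
  obtain ⟨w, u, h, hsum⟩ := exists_rankOne_kraus_of_holevoForm Φ F R hF (fun a => (hR a).1) hΦ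
  refine ⟨w, u, h, ?_⟩
  rw [hsum, ← hFsum]
  exact Finset.sum_congr rfl fun a _ => by rw [(hR a).2, one_smul]

omit [DecidableEq n] [DecidableEq m] in
/-- **Theorem 4, (D) ⇒ complete positivity**: a map with rank-one Kraus operators is completely positive
(`(1 ⊗ Φ)(X) = Σ_t (1 ⊗ A_t) X (1 ⊗ A_t)^* ⪰ 0`). [cite: HorodeckiShorRuskai2003, Theorem 4 ((D))]
[cite: Choi1975, Theorem 1] -/
theorem amp_posSemidef_of_rankOne_kraus {σ : Type*} [Fintype σ] {Φ : Matrix n n ℂ → Matrix m m ℂ}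
    (w : σ → m → ℂ) (u : σ → n → ℂ)
    (hΦ : ∀ X, Φ X = ∑ t, vecMulVec (w t) (star (u t)) * X * (vecMulVec (w t) (star (u t)))ᴴ)
    {X : Matrix (p × n) (p × n) ℂ} (hX : X.PosSemidef) :
    (comp p p m m ℂ (((comp p p n n ℂ).symm X).map Φ)).PosSemidef :=
  amp_posSemidef_of_kraus (fun t => (vecMulVec (w t) (star (u t)))ᴴ)
    (fun Y => by simp only [conjTranspose_conjTranspose]; exact hΦ Y) hX

/-- **Theorem 4, (A) ⟺ (D)**: `Φ` has a Holevo form with `F_a, R_a ⪰ 0` iff `Φ` has an operator-sum representation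
with rank-one Kraus operators. [cite: HorodeckiShorRuskai2003, Theorem 4 ((A) ⟺ (D))] -/
theorem holevoForm_iff_rankOne_kraus (Φ : Matrix n n ℂ →ₗ[ℂ] Matrix m m ℂ) :
    (∃ (κ : Type) (_ : Fintype κ) (F : κ → Matrix n n ℂ) (R : κ → Matrix m m ℂ),
      (∀ a, (F a).PosSemidef) ∧ (∀ a, (R a).PosSemidef) ∧ ∀ X, Φ X = ∑ a, (F a * X).trace • R a) ↔
    ∃ (N : ℕ) (w : Fin N → m → ℂ) (u : Fin N → n → ℂ),
      ∀ X, Φ X = ∑ t, vecMulVec (w t) (star (u t)) * X * (vecMulVec (w t) (star (u t)))ᴴ := by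
  constructor
  · rintro ⟨κ, _, F, R, hF, hR, hΦ⟩
    obtain ⟨w, u, h, -⟩ := exists_rankOne_kraus_of_holevoForm Φ F R hF hR hΦ
    let e := Fintype.equivFin (κ × n × m)
    refine ⟨Fintype.card (κ × n × m), fun t => w (e.symm t), fun t => u (e.symm t), fun X => ?_⟩
    rw [h X]
    exact (e.symm.sum_comp (fun t => vecMulVec (w t) (star (u t)) * X * (vecMulVec (w t) (star (u t)))ᴴ)).symm
  · rintro ⟨N, w, u, hΦ⟩
    exact ⟨Fin N, inferInstance, fun t => vecMulVec (u t) (star (u t)), fun t => vecMulVec (w t) (star (w t)),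
      fun t => posSemidef_vecMulVec_self_star _, fun t => posSemidef_vecMulVec_self_star _,
      fun X => (hΦ X).trans (holevoForm_of_rankOne_kraus w u X)⟩

/-- **Theorem 4, (C) ⇒ (D)**: if the normalized Choi state of `Φ` is separable then `Φ` has rank-one Kraus
operators, and `Σ_t A_t^† A_t = I` when `Φ` preserves traces. [cite: HorodeckiShorRuskai2003, Theorem 4
(«Moreover, we have also shown that (C) ⇒ (D)»)] -/
theorem exists_rankOne_kraus_of_isSeparable_choi [Nonempty n] (Φ : Matrix n n ℂ →ₗ[ℂ] Matrix m m ℂ)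
    (hsep : IsSeparable (((Fintype.card n : ℂ))⁻¹ • comp n n m m ℂ (of fun j k => Φ (single j k 1)))) :
    ∃ (N : ℕ) (w : Fin N → m → ℂ) (u : Fin N → n → ℂ),
      (∀ X, Φ X = ∑ t, vecMulVec (w t) (star (u t)) * X * (vecMulVec (w t) (star (u t)))ᴴ) ∧
      ((∀ X, (Φ X).trace = X.trace) → ∑ t, (vecMulVec (w t) (star (u t)))ᴴ * vecMulVec (w t) (star (u t)) = 1) := by
  obtain ⟨κ, _, F, R, hF, hR, hΦ, hpovm⟩ := holevoForm_of_isSeparable_choi Φ hsep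
  obtain ⟨w, u, h, hsum⟩ := exists_rankOne_kraus_of_holevoForm Φ F R hF (fun a => (hR a).1) hΦ
  let e := Fintype.equivFin (κ × n × m)
  refine ⟨Fintype.card (κ × n × m), fun t => w (e.symm t), fun t => u (e.symm t), fun X => ?_, fun htp => ?_⟩
  · rw [h X]
    exact (e.symm.sum_comp (fun t => vecMulVec (w t) (star (u t)) * X * (vecMulVec (w t) (star (u t)))ᴴ)).symm
  · rw [e.symm.sum_comp (fun t => (vecMulVec (w t) (star (u t)))ᴴ * vecMulVec (w t) (star (u t))), hsum,
      ← hpovm htp]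
    exact Finset.sum_congr rfl fun a _ => by rw [(hR a).2, one_smul]

end AtoD

/-! ## § 2 (A) ⇒ (E) and (A) ⇒ (F): composing a Holevo form with a positive map -/

section AtoEF

omit [DecidableEq m] in
/-- **A Holevo-form map is completely positive**: `(1_p ⊗ Φ)(X) = Σ_a G_a ⊗ R_a ⪰ 0` with the block traces
`G_a ⪰ 0`. [cite: HorodeckiShorRuskai2003, Theorem 4 ((A) ⇒ (B): «`(I ⊗ Φ)(Γ) = Σ_k γ_k R_k ⊗ Q_k`»)] -/
theorem amp_posSemidef_of_holevoForm (Φ : Matrix n n ℂ →ₗ[ℂ] Matrix m m ℂ) (F : ι → Matrix n n ℂ)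
    (R : ι → Matrix m m ℂ) (hF : ∀ a, (F a).PosSemidef) (hR : ∀ a, (R a).PosSemidef)
    (hΦ : ∀ X, Φ X = ∑ a, (F a * X).trace • R a) {X : Matrix (p × n) (p × n) ℂ} (hX : X.PosSemidef) :
    (comp p p m m ℂ (((comp p p n n ℂ).symm X).map Φ)).PosSemidef := by
  rw [amp_holevoForm Φ F R hΦ X]
  exact posSemidef_sum _ fun a _ => (posSemidef_blockTrace (hF a) hX).kronecker (hR a)

omit [Fintype m] [DecidableEq m] [DecidableEq q] in
/-- **Theorem 4, (A) ⇒ (E)**: for a positivity preserving `Υ`, `Υ ∘ Φ` has the Holevo form `(F_a, Υ(R_a))` and is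
therefore completely positive. [cite: HorodeckiShorRuskai2003, Theorem 4 ((A) ⇒ (E))] -/
theorem amp_comp_posSemidef_of_holevoForm (Φ : Matrix n n ℂ →ₗ[ℂ] Matrix m m ℂ) (F : ι → Matrix n n ℂ)
    (R : ι → Matrix m m ℂ) (hF : ∀ a, (F a).PosSemidef) (hR : ∀ a, (R a).PosSemidef)
    (hΦ : ∀ X, Φ X = ∑ a, (F a * X).trace • R a) (Υ : Matrix m m ℂ →ₗ[ℂ] Matrix q q ℂ)
    (hΥ : ∀ Y, Y.PosSemidef → (Υ Y).PosSemidef) {X : Matrix (p × n) (p × n) ℂ} (hX : X.PosSemidef) :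
    (comp p p q q ℂ (((comp p p n n ℂ).symm X).map (Υ ∘ₗ Φ))).PosSemidef :=
  amp_posSemidef_of_holevoForm (Υ ∘ₗ Φ) F (fun a => Υ (R a)) hF (fun a => hΥ _ (hR a))
    (fun X => by rw [LinearMap.comp_apply, hΦ, map_sum]; simp_rw [map_smul]) hX

omit [Fintype m] [DecidableEq m] in
/-- **«The map `Φ ∘ Υ` is achieved by replacing `E_k` by `Υ̂(E_k)`»**: if `Φ(X) = Σ_a Tr(F_a X) R_a` with
`F_a ⪰ 0` and `Θ = Υ̂` is the adjoint of a positivity preserving `Υ` (`Tr((Θ B)^* A) = Tr(B^* Υ(A))`), then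
`Φ(Υ(Y)) = Σ_a Tr(Θ(F_a) Y) R_a`. [cite: HorodeckiShorRuskai2003, Theorem 4 ((A) ⇒ (F))] -/
theorem holevoForm_comp_of_adjoint (Φ : Matrix n n ℂ →ₗ[ℂ] Matrix m m ℂ) (F : ι → Matrix n n ℂ)
    (R : ι → Matrix m m ℂ) (hF : ∀ a, (F a).PosSemidef) (hΦ : ∀ X, Φ X = ∑ a, (F a * X).trace • R a)
    {Υ : Matrix q q ℂ →ₗ[ℂ] Matrix n n ℂ} {Θ : Matrix n n ℂ →ₗ[ℂ] Matrix q q ℂ}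
    (hΘ : ∀ A B, ((Θ B)ᴴ * A).trace = (Bᴴ * Υ A).trace) (hΥ : ∀ Y, Y.PosSemidef → (Υ Y).PosSemidef)
    (Y : Matrix q q ℂ) : Φ (Υ Y) = ∑ a, (Θ (F a) * Y).trace • R a := by
  rw [hΦ]
  refine Finset.sum_congr rfl fun a _ => ?_
  congr 1
  calc (F a * Υ Y).trace = ((F a)ᴴ * Υ Y).trace := by rw [(hF a).1.eq]
    _ = ((Θ (F a))ᴴ * Y).trace := (hΘ Y (F a)).symm
    _ = (Θ (F a) * Y).trace := by rw [(adjoint_positive hΘ hΥ _ (hF a)).1.eq]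

omit [Fintype m] [DecidableEq m] in
/-- **«The adjoint of a positivity and trace preserving map preserves POVM's»**: `Σ_a Υ̂(F_a) = Υ̂(I) = I`.
[cite: HorodeckiShorRuskai2003, Theorem 4 (remark after the proof)] [cite: Watrous2018, Theorem 2.26] -/
theorem sum_adjoint_eq_one (F : ι → Matrix n n ℂ) (hFsum : ∑ a, F a = 1)
    {Υ : Matrix q q ℂ →ₗ[ℂ] Matrix n n ℂ} {Θ : Matrix n n ℂ →ₗ[ℂ] Matrix q q ℂ}
    (hΘ : ∀ A B, ((Θ B)ᴴ * A).trace = (Bᴴ * Υ A).trace) (htp : ∀ Y, (Υ Y).trace = Y.trace) :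
    ∑ a, Θ (F a) = 1 := by
  rw [← map_sum, hFsum]
  exact (tracePreserving_iff_adjoint_map_one hΘ).mp htp

omit [DecidableEq m] in
/-- **Theorem 4, (A) ⇒ (F)**: for a positivity preserving `Υ : M_q → M_n`, `Φ ∘ Υ` has the Holevo form
`(Υ̂(F_a), R_a)` (`Υ̂` positive by Proposition 2.18) and is therefore completely positive.
[cite: HorodeckiShorRuskai2003, Theorem 4 ((A) ⇒ (F))] [cite: Watrous2018, Proposition 2.18] -/
theorem comp_amp_posSemidef_of_holevoForm (Φ : Matrix n n ℂ →ₗ[ℂ] Matrix m m ℂ) (F : ι → Matrix n n ℂ)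
    (R : ι → Matrix m m ℂ) (hF : ∀ a, (F a).PosSemidef) (hR : ∀ a, (R a).PosSemidef)
    (hΦ : ∀ X, Φ X = ∑ a, (F a * X).trace • R a) (Υ : Matrix q q ℂ →ₗ[ℂ] Matrix n n ℂ)
    (hΥ : ∀ Y, Y.PosSemidef → (Υ Y).PosSemidef) {X : Matrix (p × q) (p × q) ℂ} (hX : X.PosSemidef) :
    (comp p p m m ℂ (((comp p p q q ℂ).symm X).map (Φ ∘ₗ Υ))).PosSemidef := by
  obtain ⟨Θ, hΘ⟩ := exists_adjoint Υ
  exact amp_posSemidef_of_holevoForm (Φ ∘ₗ Υ) (fun a => Θ (F a)) R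
    (fun a => adjoint_positive hΘ hΥ _ (hF a)) hR
    (fun Y => by rw [LinearMap.comp_apply]; exact holevoForm_comp_of_adjoint Φ F R hF hΦ hΘ hΥ Y) hX

omit [DecidableEq n] [DecidableEq m] [DecidableEq q] in
/-- Trace preservation composes («`Υ` is trace-preserving»). [cite: HorodeckiShorRuskai2003, Theorem 4 («with the
additional conditions that … `Υ` is trace-preserving»)] -/
theorem trace_comp_of_tracePreserving (Φ : Matrix n n ℂ →ₗ[ℂ] Matrix m m ℂ) (Υ : Matrix m m ℂ →ₗ[ℂ] Matrix q q ℂ)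
    (hΦ : ∀ X, (Φ X).trace = X.trace) (hΥ : ∀ Y, (Υ Y).trace = Y.trace) (X : Matrix n n ℂ) :
    ((Υ ∘ₗ Φ) X).trace = X.trace := by
  rw [LinearMap.comp_apply, hΥ, hΦ]

end AtoEF

/-! ## § 3 (E) ⇒ (A) and (E) ⟺ (B), through the Horodecki criterion [H3] -/

section EtoA

omit [Fintype n] [DecidableEq n] [Fintype m] [DecidableEq m] [Fintype p] [DecidableEq p] [Fintype q]
  [DecidableEq q] in
/-- Complete positivity is insensitive to re-indexing the output: if `(1 ⊗ (e·e) ∘ Φ)(X) ⪰ 0` then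
`(1 ⊗ Φ)(X) ⪰ 0`. [folklore] -/
private theorem amp_posSemidef_of_reindex (Φ : Matrix n n ℂ →ₗ[ℂ] Matrix m m ℂ) (e : m ≃ q)
    {X : Matrix (p × n) (p × n) ℂ}
    (h : (comp p p q q ℂ (((comp p p n n ℂ).symm X).map
      ((reindexLinearEquiv ℂ ℂ e e).toLinearMap ∘ₗ Φ))).PosSemidef) :
    (comp p p m m ℂ (((comp p p n n ℂ).symm X).map Φ)).PosSemidef := by
  have hsub : comp p p q q ℂ (((comp p p n n ℂ).symm X).map ((reindexLinearEquiv ℂ ℂ e e).toLinearMap ∘ₗ Φ)) =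
      (comp p p m m ℂ (((comp p p n n ℂ).symm X).map Φ)).submatrix (Prod.map id e.symm) (Prod.map id e.symm) := by
    ext ⟨a, i⟩ ⟨a', i'⟩
    rfl
  rw [hsub] at h
  exact (posSemidef_submatrix_equiv ((Equiv.refl p).prodCongr e.symm)).mp h

omit [Fintype n] [DecidableEq n] [DecidableEq m] [DecidableEq p] in
/-- **(E) ⇒ `Φ` is completely positive** (take `Υ` = a re-indexing `M_m ≅ M_{|m|}`, a positive map).
[cite: HorodeckiShorRuskai2003, Theorem 4 ((E))] -/
theorem amp_posSemidef_of_cp_comp_positive (Φ : Matrix n n ℂ →ₗ[ℂ] Matrix m m ℂ)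
    (hE : ∀ (k : ℕ) (Υ : Matrix m m ℂ →ₗ[ℂ] Matrix (Fin k) (Fin k) ℂ),
      (∀ Y, Y.PosSemidef → (Υ Y).PosSemidef) →
      ∀ (l : ℕ) (X : Matrix (Fin l × n) (Fin l × n) ℂ), X.PosSemidef →
        (comp (Fin l) (Fin l) (Fin k) (Fin k) ℂ (((comp (Fin l) (Fin l) n n ℂ).symm X).map (Υ ∘ₗ Φ))).PosSemidef)
    {X : Matrix (p × n) (p × n) ℂ} (hX : X.PosSemidef) :
    (comp p p m m ℂ (((comp p p n n ℂ).symm X).map Φ)).PosSemidef := by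
  set e : m ≃ Fin (Fintype.card m) := Fintype.equivFin m
  have hpos : ∀ Y : Matrix m m ℂ, Y.PosSemidef →
      (((reindexLinearEquiv ℂ ℂ e e).toLinearMap : Matrix m m ℂ →ₗ[ℂ] _) Y).PosSemidef := fun Y hY => by
    rw [LinearEquiv.coe_coe, coe_reindexLinearEquiv, reindex_apply]
    exact (posSemidef_submatrix_equiv e.symm).mpr hY
  exact amp_posSemidef_of_reindex Φ e (amp_posSemidef_of_forall_fin _ (hE _ _ hpos) hX)

/-- **(E) ⇒ the Choi matrix of `Φ` is a separable operator**: `J(Φ) ⪰ 0` and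
`(1 ⊗ Υ)(J(Φ)) = (1 ⊗ Υ∘Φ)(J(𝟙)) ⪰ 0` for every positive `Υ`, so [H3] applies.
[cite: HorodeckiShorRuskai2003, Theorem 4 ((E) ⇒ (B), «[H3]»)] [cite: Watrous2018, Theorem 6.9] -/
theorem choi_eq_sum_kronecker_of_cp_comp_positive (Φ : Matrix n n ℂ →ₗ[ℂ] Matrix m m ℂ)
    (hE : ∀ (k : ℕ) (Υ : Matrix m m ℂ →ₗ[ℂ] Matrix (Fin k) (Fin k) ℂ),
      (∀ Y, Y.PosSemidef → (Υ Y).PosSemidef) →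
      ∀ (l : ℕ) (X : Matrix (Fin l × n) (Fin l × n) ℂ), X.PosSemidef →
        (comp (Fin l) (Fin l) (Fin k) (Fin k) ℂ (((comp (Fin l) (Fin l) n n ℂ).symm X).map (Υ ∘ₗ Φ))).PosSemidef) :
    ∃ (κ : Type) (_ : Fintype κ) (P : κ → Matrix n n ℂ) (Q : κ → Matrix m m ℂ),
      (∀ a, (P a).PosSemidef) ∧ (∀ a, (Q a).PosSemidef) ∧
      comp n n m m ℂ (of fun j k => Φ (single j k 1)) = ∑ a, P a ⊗ₖ Q a := by
  have hC : (comp n n m m ℂ (of fun j k => Φ (single j k 1))).PosSemidef :=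
    (choi_theorem_2 Φ).mp fun k X hX => amp_posSemidef_of_cp_comp_positive Φ hE hX
  refine (horodecki_criterion hC).mpr fun k Υ hΥ => ?_
  have h := amp_posSemidef_of_forall_fin _ (hE k Υ hΥ) (posSemidef_comp_single (n := n))
  rw [LinearMap.coe_comp, amp_comp] at h
  rwa [choi_eq_amp]

omit [Fintype m] [DecidableEq m] in
/-- **From a separable Choi operator to the Holevo form**: if `J(Φ) = Σ_a P_a ⊗ Q_a` then
`Φ(X) = Σ_a Tr(P_aᵀ X) Q_a` (both sides are linear and agree on the matrix units).
[cite: HorodeckiShorRuskai2003, Theorem 4 ((C) ⇒ (A): «Since a map `Φ` is uniquely determined by its action on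
the basis `|j⟩⟨k|` … we can conclude that `Φ = Ω`»)] -/
theorem holevoForm_of_choi_eq_sum_kronecker (Φ : Matrix n n ℂ →ₗ[ℂ] Matrix m m ℂ) {κ : Type*} [Fintype κ]
    (P : κ → Matrix n n ℂ) (Q : κ → Matrix m m ℂ)
    (hJ : comp n n m m ℂ (of fun j k => Φ (single j k 1)) = ∑ a, P a ⊗ₖ Q a) (X : Matrix n n ℂ) :
    Φ X = ∑ a, ((P a)ᵀ * X).trace • Q a := by
  let Ψ : Matrix n n ℂ →ₗ[ℂ] Matrix m m ℂ :=
    { toFun := fun X => ∑ a, ((P a)ᵀ * X).trace • Q a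
      map_add' := fun X Y => by
        simp only [Matrix.mul_add, trace_add, add_smul, Finset.sum_add_distrib]
      map_smul' := fun r X => by
        simp only [Matrix.mul_smul, trace_smul, smul_eq_mul, RingHom.id_apply, Finset.smul_sum, smul_smul] }
  have hΦΨ : Φ = Ψ := by
    refine eq_of_apply_single_eq Φ Ψ fun j k => ?_
    ext a b
    have h : Φ (single j k 1) a b = ∑ x, (P x ⊗ₖ Q x) (j, a) (k, b) := by
      have h := congrFun (congrFun hJ (j, a)) (k, b)
      rw [Matrix.sum_apply] at h
      exact h
    rw [h]
    change _ = (∑ x, ((P x)ᵀ * single j k (1 : ℂ)).trace • Q x) a b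
    rw [Matrix.sum_apply]
    refine Finset.sum_congr rfl fun x _ => ?_
    rw [kroneckerMap_apply, Matrix.smul_apply, trace_mul_single, MulOpposite.op_one, one_smul, transpose_apply,
      smul_eq_mul]
  exact congrFun (congrArg DFunLike.coe hΦΨ) X

/-- **Theorem 4, (E) ⇒ (A)**: if `Υ ∘ Φ` is completely positive for every positivity preserving `Υ` (into any
`M_k(ℂ)`), then `Φ(X) = Σ_a Tr(F_a X) R_a` with `F_a, R_a ⪰ 0`. [cite: HorodeckiShorRuskai2003, Theorem 4
((E) ⇒ (B) ⇒ (C) ⇒ (A))] [cite: Watrous2018, Theorem 6.9] -/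
theorem holevoForm_of_cp_comp_positive (Φ : Matrix n n ℂ →ₗ[ℂ] Matrix m m ℂ)
    (hE : ∀ (k : ℕ) (Υ : Matrix m m ℂ →ₗ[ℂ] Matrix (Fin k) (Fin k) ℂ),
      (∀ Y, Y.PosSemidef → (Υ Y).PosSemidef) →
      ∀ (l : ℕ) (X : Matrix (Fin l × n) (Fin l × n) ℂ), X.PosSemidef →
        (comp (Fin l) (Fin l) (Fin k) (Fin k) ℂ (((comp (Fin l) (Fin l) n n ℂ).symm X).map (Υ ∘ₗ Φ))).PosSemidef) :
    ∃ (κ : Type) (_ : Fintype κ) (F : κ → Matrix n n ℂ) (R : κ → Matrix m m ℂ),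
      (∀ a, (F a).PosSemidef) ∧ (∀ a, (R a).PosSemidef) ∧ ∀ X, Φ X = ∑ a, (F a * X).trace • R a := by
  obtain ⟨κ, _, P, Q, hP, hQ, hJ⟩ := choi_eq_sum_kronecker_of_cp_comp_positive Φ hE
  exact ⟨κ, inferInstance, fun a => (P a)ᵀ, Q, fun a => (hP a).transpose, hQ,
    holevoForm_of_choi_eq_sum_kronecker Φ P Q hJ⟩

omit [DecidableEq n] [DecidableEq m] [DecidableEq p] in
/-- The ampliation of a trace-preserving map preserves traces: `Tr (1 ⊗ Φ)(X) = Σ_b Tr Φ(X_bb) = Tr X`.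
[cite: HorodeckiShorRuskai2003, Theorem 4 ((E) ⇒ (B) for «CPT and EBT maps»)] -/
theorem trace_amp_of_tracePreserving (Φ : Matrix n n ℂ →ₗ[ℂ] Matrix m m ℂ) (htp : ∀ X, (Φ X).trace = X.trace)
    (X : Matrix (p × n) (p × n) ℂ) : (comp p p m m ℂ (((comp p p n n ℂ).symm X).map Φ)).trace = X.trace := by
  simp only [trace, Matrix.diag_apply, Fintype.sum_prod_type, amp_apply]
  refine Finset.sum_congr rfl fun b _ => ?_
  have h := htp (of fun i j => X (b, i) (b, j))
  simp only [trace, Matrix.diag_apply, of_apply] at h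
  exact h

omit [DecidableEq n] in
/-- **Theorem 4, (E) ⇒ (B) for channels**: if `Φ` is trace-preserving and `Υ ∘ Φ` is completely positive for every
positivity preserving `Υ`, then `(1 ⊗ Φ)(Γ)` is separable for every density operator `Γ` («a density matrix `Γ`
is separable if and only if `(I ⊗ Ω)(Γ) > 0` for all positivity preserving maps `Ω` [H3]», and
`(I ⊗ Ω)((I ⊗ Φ)(Γ)) = (I ⊗ Ω∘Φ)(Γ)`). [cite: HorodeckiShorRuskai2003, Theorem 4 ((E) ⇒ (B))]
[cite: Watrous2018, Theorem 6.9] -/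
theorem isSeparable_amp_of_cp_comp_positive (Φ : Matrix n n ℂ →ₗ[ℂ] Matrix m m ℂ)
    (hE : ∀ (k : ℕ) (Υ : Matrix m m ℂ →ₗ[ℂ] Matrix (Fin k) (Fin k) ℂ),
      (∀ Y, Y.PosSemidef → (Υ Y).PosSemidef) →
      ∀ (l : ℕ) (X : Matrix (Fin l × n) (Fin l × n) ℂ), X.PosSemidef →
        (comp (Fin l) (Fin l) (Fin k) (Fin k) ℂ (((comp (Fin l) (Fin l) n n ℂ).symm X).map (Υ ∘ₗ Φ))).PosSemidef)
    (htp : ∀ X, (Φ X).trace = X.trace) {X : Matrix (p × n) (p × n) ℂ} (hX : X.PosSemidef) (hX1 : X.trace = 1) :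
    IsSeparable (comp p p m m ℂ (((comp p p n n ℂ).symm X).map Φ)) := by
  have hPSD := amp_posSemidef_of_cp_comp_positive Φ hE hX
  refine isSeparable_iff_sepD.mpr ⟨?_, (horodecki_criterion hPSD).mpr fun k Υ hΥ => ?_⟩
  · rw [trace_amp_of_tracePreserving Φ htp, hX1]
  · have h := amp_posSemidef_of_forall_fin _ (hE k Υ hΥ) hX
    rwa [LinearMap.coe_comp, amp_comp] at h

omit [DecidableEq m] [DecidableEq q] in
/-- **Theorem 4, (B) ⇒ (E) for channels** (through (B) ⇒ (C) ⇒ (A) ⇒ (E)). [cite: HorodeckiShorRuskai2003,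
Theorem 4 ((B) ⇒ (E))] -/
theorem amp_comp_posSemidef_of_entanglementBreaking [Nonempty n] (Φ : Matrix n n ℂ →ₗ[ℂ] Matrix m m ℂ)
    (hEB : ∀ X : Matrix (n × n) (n × n) ℂ, X.PosSemidef → X.trace = 1 →
      IsSeparable (comp n n m m ℂ (((comp n n n n ℂ).symm X).map Φ)))
    (Υ : Matrix m m ℂ →ₗ[ℂ] Matrix q q ℂ) (hΥ : ∀ Y, Y.PosSemidef → (Υ Y).PosSemidef)
    {X : Matrix (p × n) (p × n) ℂ} (hX : X.PosSemidef) :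
    (comp p p q q ℂ (((comp p p n n ℂ).symm X).map (Υ ∘ₗ Φ))).PosSemidef := by
  obtain ⟨κ, _, F, R, hF, hR, hΦ, -⟩ :=
    holevoForm_of_isSeparable_choi Φ (isSeparable_choi_of_entanglementBreaking Φ hEB)
  exact amp_comp_posSemidef_of_holevoForm Φ F R hF (fun a => (hR a).1) hΦ Υ hΥ hX

/-- **Theorem 4, (A) ⟺ (E)**: `Φ` has a Holevo form with `F_a, R_a ⪰ 0` iff `Υ ∘ Φ` is completely positive for every
positivity preserving `Υ`. [cite: HorodeckiShorRuskai2003, Theorem 4 ((A) ⟺ (E))] [cite: Watrous2018, Theorem 6.9] -/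
theorem holevoForm_iff_cp_comp_positive (Φ : Matrix n n ℂ →ₗ[ℂ] Matrix m m ℂ) :
    (∃ (κ : Type) (_ : Fintype κ) (F : κ → Matrix n n ℂ) (R : κ → Matrix m m ℂ),
      (∀ a, (F a).PosSemidef) ∧ (∀ a, (R a).PosSemidef) ∧ ∀ X, Φ X = ∑ a, (F a * X).trace • R a) ↔
    ∀ (k : ℕ) (Υ : Matrix m m ℂ →ₗ[ℂ] Matrix (Fin k) (Fin k) ℂ),
      (∀ Y, Y.PosSemidef → (Υ Y).PosSemidef) →
      ∀ (l : ℕ) (X : Matrix (Fin l × n) (Fin l × n) ℂ), X.PosSemidef →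
        (comp (Fin l) (Fin l) (Fin k) (Fin k) ℂ (((comp (Fin l) (Fin l) n n ℂ).symm X).map (Υ ∘ₗ Φ))).PosSemidef :=
  ⟨fun ⟨_, _, F, R, hF, hR, hΦ⟩ _ Υ hΥ _ _ hX => amp_comp_posSemidef_of_holevoForm Φ F R hF hR hΦ Υ hΥ hX,
    fun hE => holevoForm_of_cp_comp_positive Φ hE⟩

/-- **Theorem 4, (B) ⟺ (E) for channels** («A corresponding equivalence holds for CPT and EBT maps»): a
trace-preserving `Φ` is entanglement breaking iff `Υ ∘ Φ` is completely positive for every positivity preserving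
`Υ`. [cite: HorodeckiShorRuskai2003, Theorem 4 ((B) ⟺ (E))] [cite: Watrous2018, Theorem 6.9] -/
theorem entanglementBreaking_iff_cp_comp_positive [Nonempty n] (Φ : Matrix n n ℂ →ₗ[ℂ] Matrix m m ℂ)
    (htp : ∀ X, (Φ X).trace = X.trace) :
    (∀ X : Matrix (n × n) (n × n) ℂ, X.PosSemidef → X.trace = 1 →
      IsSeparable (comp n n m m ℂ (((comp n n n n ℂ).symm X).map Φ))) ↔
    ∀ (k : ℕ) (Υ : Matrix m m ℂ →ₗ[ℂ] Matrix (Fin k) (Fin k) ℂ),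
      (∀ Y, Y.PosSemidef → (Υ Y).PosSemidef) →
      ∀ (l : ℕ) (X : Matrix (Fin l × n) (Fin l × n) ℂ), X.PosSemidef →
        (comp (Fin l) (Fin l) (Fin k) (Fin k) ℂ (((comp (Fin l) (Fin l) n n ℂ).symm X).map (Υ ∘ₗ Φ))).PosSemidef :=
  ⟨fun hEB _ Υ hΥ _ _ hX => amp_comp_posSemidef_of_entanglementBreaking Φ hEB Υ hΥ hX,
    fun hE _ hX hX1 => isSeparable_amp_of_cp_comp_positive Φ hE htp hX hX1⟩

end EtoA

/-! ## § 4 (F) ⇒ (A), through adjoints -/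

section FtoA

omit [DecidableEq n] in
/-- **The adjoint of a Holevo form**: if `Ψ(Y) = Σ_a Tr(F_a Y) R_a` with `F_a, R_a` Hermitian and `Φ = Ψ̂`
(`Tr((Ψ Y)^* X) = Tr(Y^* Φ(X))`), then `Φ(X) = Σ_a Tr(R_a X) F_a`. [cite: HorodeckiShorRuskai2003, Theorem 4
((F): «`Tr [Ω̂(A)]^† B = Tr A^† Ω(B)`»)] -/
theorem holevoForm_of_adjoint_holevoForm {κ : Type*} [Fintype κ] {Φ : Matrix n n ℂ →ₗ[ℂ] Matrix m m ℂ}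
    {Ψ : Matrix m m ℂ →ₗ[ℂ] Matrix n n ℂ} (hadj : ∀ X Y, ((Ψ Y)ᴴ * X).trace = (Yᴴ * Φ X).trace)
    (F : κ → Matrix m m ℂ) (R : κ → Matrix n n ℂ) (hF : ∀ a, (F a).IsHermitian) (hR : ∀ a, (R a).IsHermitian)
    (hΨ : ∀ Y, Ψ Y = ∑ a, (F a * Y).trace • R a) (X : Matrix n n ℂ) :
    Φ X = ∑ a, (R a * X).trace • F a := by
  refine eq_of_forall_trace_conjTranspose_mul_eq fun Y => ?_
  rw [adjoint_symm hadj Y X, hΨ Y, Matrix.mul_sum, trace_sum, conjTranspose_sum, Finset.sum_mul, trace_sum]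
  refine Finset.sum_congr rfl fun a _ => ?_
  rw [Matrix.mul_smul, trace_smul, conjTranspose_smul, Matrix.smul_mul, trace_smul, (hF a).eq, smul_eq_mul,
    smul_eq_mul, ← trace_conjTranspose, conjTranspose_mul, (hR a).eq, mul_comm]

omit [DecidableEq n] [DecidableEq m] in
/-- **`(Φ ∘ Υ)^ = Υ̂ ∘ Φ̂` for a Kraus map**: if `Φ(Θ(A)) = Σ_i V_i^* A V_i`, `Ψ = Φ̂` and `Θ = Υ̂`, then
`Υ(Ψ(B)) = Σ_i V_i B V_i^*` — again an operator-sum. [cite: HorodeckiShorRuskai2003, Theorem 4 ((F):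
«`(Φ ∘ Υ)^ = Υ̂ ∘ Φ̂`»)] [cite: Watrous2018, Proposition 2.18 (Remark)] -/
theorem kraus_comp_adjoint {σ : Type*} [Fintype σ] {Φ : Matrix n n ℂ →ₗ[ℂ] Matrix m m ℂ}
    {Ψ : Matrix m m ℂ →ₗ[ℂ] Matrix n n ℂ} (hΨ : ∀ X Y, ((Ψ Y)ᴴ * X).trace = (Yᴴ * Φ X).trace)
    {Υ : Matrix n n ℂ →ₗ[ℂ] Matrix q q ℂ} {Θ : Matrix q q ℂ →ₗ[ℂ] Matrix n n ℂ}
    (hΘ : ∀ A B, ((Θ B)ᴴ * A).trace = (Bᴴ * Υ A).trace) (V : σ → Matrix q m ℂ)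
    (hV : ∀ A, Φ (Θ A) = ∑ i, (V i)ᴴ * A * V i) (B : Matrix m m ℂ) :
    Υ (Ψ B) = ∑ i, V i * B * (V i)ᴴ := by
  refine eq_of_forall_trace_conjTranspose_mul_eq fun A => ?_
  rw [adjoint_symm hΘ A (Ψ B), hΨ (Θ A) B, hV A]
  exact trace_conjTranspose_kraus_mul V A B

/-- **Theorem 4, (F) ⇒ (A)**: if `Φ ∘ Υ` is completely positive for every positivity preserving `Υ` (out of any
`M_k(ℂ)`), then `Φ(X) = Σ_a Tr(F_a X) R_a` with `F_a, R_a ⪰ 0` — the adjoint `Φ̂` satisfies (E), hence has a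
Holevo form, and `Φ = Φ̂^`. [cite: HorodeckiShorRuskai2003, Theorem 4 ((F) ⟺ (E))]
[cite: Watrous2018, Proposition 2.18] -/
theorem holevoForm_of_comp_cp_positive (Φ : Matrix n n ℂ →ₗ[ℂ] Matrix m m ℂ)
    (hF : ∀ (k : ℕ) (Υ : Matrix (Fin k) (Fin k) ℂ →ₗ[ℂ] Matrix n n ℂ),
      (∀ Y, Y.PosSemidef → (Υ Y).PosSemidef) →
      ∀ (l : ℕ) (X : Matrix (Fin l × Fin k) (Fin l × Fin k) ℂ), X.PosSemidef →
        (comp (Fin l) (Fin l) m m ℂ (((comp (Fin l) (Fin l) (Fin k) (Fin k) ℂ).symm X).map (Φ ∘ₗ Υ))).PosSemidef) :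
    ∃ (κ : Type) (_ : Fintype κ) (F : κ → Matrix n n ℂ) (R : κ → Matrix m m ℂ),
      (∀ a, (F a).PosSemidef) ∧ (∀ a, (R a).PosSemidef) ∧ ∀ X, Φ X = ∑ a, (F a * X).trace • R a := by
  obtain ⟨Ψ, hΨ⟩ := exists_adjoint Φ
  -- `Ψ = Φ̂` satisfies (E)
  have hE : ∀ (k : ℕ) (Υ : Matrix n n ℂ →ₗ[ℂ] Matrix (Fin k) (Fin k) ℂ),
      (∀ Y, Y.PosSemidef → (Υ Y).PosSemidef) →
      ∀ (l : ℕ) (X : Matrix (Fin l × m) (Fin l × m) ℂ), X.PosSemidef →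
        (comp (Fin l) (Fin l) (Fin k) (Fin k) ℂ (((comp (Fin l) (Fin l) m m ℂ).symm X).map (Υ ∘ₗ Ψ))).PosSemidef := by
    intro k Υ hΥ l X hX
    obtain ⟨Θ, hΘ⟩ := exists_adjoint Υ
    have hΘpos : ∀ B, B.PosSemidef → (Θ B).PosSemidef := adjoint_positive hΘ hΥ
    obtain ⟨ℓ, V, hV⟩ := (choi_theorem_1 (Φ ∘ₗ Θ)).mp (hF k Θ hΘpos)
    have hV' : ∀ A, Φ (Θ A) = ∑ i, (V i)ᴴ * A * V i := fun A => hV A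
    refine amp_posSemidef_of_kraus (Φ := ⇑(Υ ∘ₗ Ψ)) (fun i => (V i)ᴴ) (fun B => ?_) hX
    simp only [LinearMap.comp_apply, conjTranspose_conjTranspose]
    exact kraus_comp_adjoint hΨ hΘ V hV' B
  obtain ⟨κ, _, F', R', hF', hR', hΨform⟩ := holevoForm_of_cp_comp_positive Ψ hE
  exact ⟨κ, inferInstance, R', F', hR', hF',
    holevoForm_of_adjoint_holevoForm hΨ F' R' (fun a => (hF' a).1) (fun a => (hR' a).1) hΨform⟩

/-- **Theorem 4, (A) ⟺ (F)**: `Φ` has a Holevo form with `F_a, R_a ⪰ 0` iff `Φ ∘ Υ` is completely positive for every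
positivity preserving `Υ`. [cite: HorodeckiShorRuskai2003, Theorem 4 ((A) ⟺ (F))] [cite: Watrous2018, Theorem 6.9,
Proposition 2.18] -/
theorem holevoForm_iff_comp_cp_positive (Φ : Matrix n n ℂ →ₗ[ℂ] Matrix m m ℂ) :
    (∃ (κ : Type) (_ : Fintype κ) (F : κ → Matrix n n ℂ) (R : κ → Matrix m m ℂ),
      (∀ a, (F a).PosSemidef) ∧ (∀ a, (R a).PosSemidef) ∧ ∀ X, Φ X = ∑ a, (F a * X).trace • R a) ↔
    ∀ (k : ℕ) (Υ : Matrix (Fin k) (Fin k) ℂ →ₗ[ℂ] Matrix n n ℂ),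
      (∀ Y, Y.PosSemidef → (Υ Y).PosSemidef) →
      ∀ (l : ℕ) (X : Matrix (Fin l × Fin k) (Fin l × Fin k) ℂ), X.PosSemidef →
        (comp (Fin l) (Fin l) m m ℂ (((comp (Fin l) (Fin l) (Fin k) (Fin k) ℂ).symm X).map (Φ ∘ₗ Υ))).PosSemidef :=
  ⟨fun ⟨_, _, F, R, hF, hR, hΦ⟩ _ Υ hΥ _ _ hX => comp_amp_posSemidef_of_holevoForm Φ F R hF hR hΦ Υ hΥ hX,
    fun h => holevoForm_of_comp_cp_positive Φ h⟩

end FtoA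

end Literature.InformationTheory.Entanglement.EntanglementBreakingConditions
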